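import Literature.Computability.Cryptography.WordRAMBlocks
import Mathlib.Algebra.Order.BigOperators.Group.Finset
import HarnessLib

/-!
# The word RAM — structured code and a verified compiler

A small structured programming layer over the word RAM of
`Literature.Computability.Cryptography.WordRAM`, in the style of a certified compiler for a
`WHILE` language (Nipkow–Klein, *Concrete Semantics*, Ch. 7–8; Winskel, *The Formal Semantics of
Programming Languages*, Ch. 2): verified word-RAM programs (the reductions of VW–W 2018, the
inline simulations behind VVW ICM 2018, Def. 2.1) are written as structured code and reasoned
about compositionally, and only the compiler is verified at the level of program counters.

* `SProg`: structured code — a single three-address instruction `op`, an oracle `query`, `skip`,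
  sequencing, `ifz x s t` (if the operand reads `0` run `s`, else `t`) and `whilenz x s` (while the
  operand reads nonzero, run `s`);
* `SProg.compile s b`: its machine code when placed at program counter `b` (jump targets are
  absolute), of length `SProg.len s` independent of `b`; `SProg.toProgram s = s.compile 0 ++ [halt]`;
* `Store` (memory and query log) and the big-step semantics `SProg.Exec w O s st st' t`: running `s`
  at word size `w` with oracle `O` from store `st` ends in store `st'` after *exactly* `t` machine
  steps of the compiled code (one step per executed `op`/`query`/test/jump);
* **compiler correctness** `SProg.Exec.run_eq`: if `s.compile b` sits inside `P` at `b`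
  (`CodeAt P b (s.compile b)`) and `Exec w O s st st' t`, then `run P w O ρ t` takes the
  configuration `⟨b, st⟩` to `⟨b + s.len, st'⟩`; whence `SProg.haltsWithin_toProgram`
  (a `HaltsWithin` certificate for `s.toProgram` in `t + 1` steps) and `outputsWithin_toProgram`;
* the loop rule `SProg.Exec.whilenz_iter` (an indexed family of stores threaded through `N`
  iterations gives an `Exec` of the loop with the summed time) and its constant-bound form
  `SProg.ExecLE.whilenz_iter` for the time-bounded variant `ExecLE` (`∃ t ≤ T, Exec … t`);
* `SProg.toProgram_isDeterministic` (compiled code has no `rand`), `SProg.toProgram_isOracleFree`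
  for query-free code, and exact evaluation lemmas for the arithmetic of `BinOp.eval` below the
  word size (`BinOp.eval_add_of_lt`, `eval_sub_of_le`, `eval_mul_of_lt`, …).

## References

* T. Nipkow, G. Klein, *Concrete Semantics with Isabelle/HOL*, Springer 2014, §7.2 (big-step
  semantics), §8.3–8.4 (compiler correctness for `WHILE`).
* T. Hagerup, *Sorting and searching on the word RAM*, STACS 1998, §2 (the machine).
* V. Vassilevska Williams, *On some fine-grained questions in algorithms and complexity*,
  Proc. ICM 2018, §2.
-/

namespace Literature.Computability.Cryptography.WordRAM

open StateTransition

/-! ## Exact arithmetic below the word size -/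

section BinOp

variable {w x y : ℕ}

/-- Addition without overflow is exact. [folklore] -/
theorem BinOp.eval_add_of_lt (h : x + y < 2 ^ w) : BinOp.add.eval w x y = x + y :=
  Nat.mod_eq_of_lt h

/-- Subtraction of a smaller word is exact. [folklore] -/
theorem BinOp.eval_sub_of_le (h : y ≤ x) (hx : x < 2 ^ w) : BinOp.sub.eval w x y = x - y := by
  show (x + 2 ^ w - y % 2 ^ w) % 2 ^ w = x - y
  rw [Nat.mod_eq_of_lt (lt_of_le_of_lt h hx), Nat.sub_add_comm h, Nat.add_mod_right,
    Nat.mod_eq_of_lt (lt_of_le_of_lt (Nat.sub_le x y) hx)]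

/-- Multiplication without overflow is exact. [folklore] -/
theorem BinOp.eval_mul_of_lt (h : x * y < 2 ^ w) : BinOp.mul.eval w x y = x * y :=
  Nat.mod_eq_of_lt h

/-- Division is exact. [folklore] -/
@[simp] theorem BinOp.eval_div : BinOp.div.eval w x y = x / y := rfl

/-- Remainder is exact. [folklore] -/
@[simp] theorem BinOp.eval_mod : BinOp.mod.eval w x y = x % y := rfl

/-- Bitwise `and` is exact. [folklore] -/
@[simp] theorem BinOp.eval_band : BinOp.band.eval w x y = x &&& y := rfl

/-- Right shift is exact. [folklore] -/
@[simp] theorem BinOp.eval_shr : BinOp.shr.eval w x y = x >>> y := rfl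

/-- The comparison `<` returns `1`/`0`. [folklore] -/
@[simp] theorem BinOp.eval_lt : BinOp.lt.eval w x y = if x < y then 1 else 0 := rfl

/-- The comparison `=` returns `1`/`0`. [folklore] -/
@[simp] theorem BinOp.eval_eq : BinOp.eq.eval w x y = if x = y then 1 else 0 := rfl

/-- Bitwise `or` of words is exact. [folklore] -/
theorem BinOp.eval_bor_of_lt (hx : x < 2 ^ w) (hy : y < 2 ^ w) : BinOp.bor.eval w x y = x ||| y :=
  Nat.mod_eq_of_lt (Nat.or_lt_two_pow hx hy)

/-- Bitwise `xor` of words is exact. [folklore] -/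
theorem BinOp.eval_bxor_of_lt (hx : x < 2 ^ w) (hy : y < 2 ^ w) : BinOp.bxor.eval w x y = x ^^^ y :=
  Nat.mod_eq_of_lt (Nat.xor_lt_two_pow hx hy)

/-- Left shift without overflow is exact. [folklore] -/
theorem BinOp.eval_shl_of_lt (h : x * 2 ^ y < 2 ^ w) : BinOp.shl.eval w x y = x * 2 ^ y := by
  show (x <<< y) % 2 ^ w = x * 2 ^ y
  rw [Nat.shiftLeft_eq, Nat.mod_eq_of_lt h]

end BinOp

/-! ## Structured code -/

/-- Structured word-RAM code: single instructions, sequencing, a zero-test conditional and a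
nonzero-test loop (a `WHILE` language over word-RAM instructions; Nipkow–Klein, *Concrete
Semantics*, §7.1). [folklore] -/
inductive SProg : Type
  /-- The three-address instruction `dst := o x y`. -/
  | op (o : BinOp) (dst x y : Operand)
  /-- The oracle query instruction. -/
  | query (qa ql aa : Operand)
  /-- Do nothing (no code). -/
  | skip
  /-- Run `s`, then `t`. -/
  | seq (s t : SProg)
  /-- If operand `x` reads `0` run `s`, otherwise run `t`. -/
  | ifz (x : Operand) (s t : SProg)
  /-- While operand `x` reads nonzero, run `s`. -/
  | whilenz (x : Operand) (s : SProg)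

namespace SProg

/-- The length of the compiled code (independent of its placement). [folklore] -/
def len : SProg → ℕ
  | op _ _ _ _ => 1
  | query _ _ _ => 1
  | skip => 0
  | seq s t => s.len + t.len
  | ifz _ s t => s.len + t.len + 2
  | whilenz _ s => s.len + 2

/-- Compile structured code placed at program counter `b` (absolute jump targets):
`ifz x s u ↦ jz x THEN; ⟦u⟧; jmp END; THEN: ⟦s⟧; END:` (the zero branch `s` is the jump target) and
`whilenz x s ↦ TEST: jz x END; ⟦s⟧; jmp TEST; END:` (Nipkow–Klein, *Concrete Semantics*, §8.2,
with absolute instead of relative jumps). [folklore] -/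
def compile : SProg → ℕ → List Instr
  | op o d x y, _ => [.op o d x y]
  | query qa ql aa, _ => [.query qa ql aa]
  | skip, _ => []
  | seq s t, b => s.compile b ++ t.compile (b + s.len)
  | ifz x s u, b => .jz x (b + u.len + 2) :: (u.compile (b + 1) ++
      .jmp (b + (s.len + u.len + 2)) :: s.compile (b + u.len + 2))
  | whilenz x s, b => .jz x (b + (s.len + 2)) :: (s.compile (b + 1) ++ [.jmp b])

/-- The compiled code has length `len`. [folklore] -/
@[simp] theorem length_compile : ∀ (s : SProg) (b : ℕ), (s.compile b).length = s.len
  | op _ _ _ _, _ => rfl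
  | query _ _ _, _ => rfl
  | skip, _ => rfl
  | seq s t, b => by simp [compile, len, length_compile s, length_compile t]
  | ifz x s t, b => by simp [compile, len, length_compile s, length_compile t]; omega
  | whilenz x s, b => by simp [compile, len, length_compile s]

/-- The whole program of a piece of structured code: its code at `0`, followed by `halt`. [folklore] -/
def toProgram (s : SProg) : Program :=
  s.compile 0 ++ [.halt]

/-- Compiled code contains no `rand` instruction. [folklore] -/
theorem isRand_of_mem_compile : ∀ (s : SProg) (b : ℕ) (I : Instr), I ∈ s.compile b → I.isRand = false
  | op _ _ _ _, _, I, h => by simp [compile] at h; subst h; rfl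
  | query _ _ _, _, I, h => by simp [compile] at h; subst h; rfl
  | skip, _, I, h => by simp [compile] at h
  | seq s t, b, I, h => by
      simp only [compile, List.mem_append] at h
      rcases h with h | h
      exacts [isRand_of_mem_compile s _ I h, isRand_of_mem_compile t _ I h]
  | ifz x s t, b, I, h => by
      simp only [compile, List.mem_cons, List.mem_append] at h
      rcases h with rfl | h | rfl | h
      · rfl
      · exact isRand_of_mem_compile t _ I h
      · rfl
      · exact isRand_of_mem_compile s _ I h
  | whilenz x s, b, I, h => by
      simp only [compile, List.mem_cons, List.mem_append, List.not_mem_nil, or_false] at h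
      rcases h with rfl | h | rfl
      · rfl
      · exact isRand_of_mem_compile s _ I h
      · rfl

/-- Compiled programs are deterministic. [folklore] -/
theorem toProgram_isDeterministic (s : SProg) : s.toProgram.IsDeterministic := by
  intro I hI
  simp only [toProgram, List.mem_append, List.mem_singleton] at hI
  rcases hI with h | rfl
  · exact isRand_of_mem_compile s 0 I h
  · rfl

/-- `s.QueryFree`: the structured code contains no oracle query. [folklore] -/
def QueryFree : SProg → Prop
  | op _ _ _ _ => True
  | query _ _ _ => False
  | skip => True
  | seq s t => s.QueryFree ∧ t.QueryFree
  | ifz _ s t => s.QueryFree ∧ t.QueryFree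
  | whilenz _ s => s.QueryFree

/-- Query-free code compiles to `query`-free machine code. [folklore] -/
theorem isQuery_of_mem_compile :
    ∀ (s : SProg), s.QueryFree → ∀ (b : ℕ) (I : Instr), I ∈ s.compile b → I.isQuery = false
  | op _ _ _ _, _, _, I, h => by simp [compile] at h; subst h; rfl
  | query _ _ _, hq, _, _, _ => hq.elim
  | skip, _, _, I, h => by simp [compile] at h
  | seq s t, hq, b, I, h => by
      simp only [compile, List.mem_append] at h
      rcases h with h | h
      exacts [isQuery_of_mem_compile s hq.1 _ I h, isQuery_of_mem_compile t hq.2 _ I h]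
  | ifz x s t, hq, b, I, h => by
      simp only [compile, List.mem_cons, List.mem_append] at h
      rcases h with rfl | h | rfl | h
      · rfl
      · exact isQuery_of_mem_compile t hq.2 _ I h
      · rfl
      · exact isQuery_of_mem_compile s hq.1 _ I h
  | whilenz x s, hq, b, I, h => by
      simp only [compile, List.mem_cons, List.mem_append, List.not_mem_nil, or_false] at h
      rcases h with rfl | h | rfl
      · rfl
      · exact isQuery_of_mem_compile s hq _ I h
      · rfl

/-- Query-free structured code compiles to an oracle-free program. [folklore] -/
theorem toProgram_isOracleFree {s : SProg} (hs : s.QueryFree) : s.toProgram.IsOracleFree := by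
  intro I hI
  simp only [toProgram, List.mem_append, List.mem_singleton] at hI
  rcases hI with h | rfl
  · exact isQuery_of_mem_compile s hs 0 I h
  · rfl

end SProg

/-! ## Code placement

`CodeAt P b code` (from `Literature.Computability.Cryptography.WordRAMBlocks`): the instruction list
`code` occurs in `P` starting at position `b`. -/

/-- The instruction at offset `i` of placed code. [folklore] -/
theorem CodeAt.getElem? {P : Program} {b : ℕ} {code : List Instr} (h : CodeAt P b code) {i : ℕ}
    (hi : i < code.length) : P[b + i]? = some code[i] :=
  h i _ (List.getElem?_eq_getElem hi)

/-- Placed code `c₁ ++ c₂`: the left part. [folklore] -/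
theorem CodeAt.left {P : Program} {b : ℕ} {c₁ c₂ : List Instr} (h : CodeAt P b (c₁ ++ c₂)) :
    CodeAt P b c₁ :=
  (codeAt_append_iff.1 h).1

/-- Placed code `c₁ ++ c₂`: the right part is placed `|c₁|` further. [folklore] -/
theorem CodeAt.right {P : Program} {b : ℕ} {c₁ c₂ : List Instr} (h : CodeAt P b (c₁ ++ c₂)) :
    CodeAt P (b + c₁.length) c₂ :=
  (codeAt_append_iff.1 h).2

/-- Transport of a placement along an equality of positions. [folklore] -/
theorem CodeAt.of_eq {P : Program} {b b' : ℕ} {code : List Instr} (h : CodeAt P b code)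
    (hb : b = b') : CodeAt P b' code := hb ▸ h

/-- The middle of a three-part program is placed after the first part. [folklore] -/
theorem codeAt_append_middle (pre code post : List Instr) :
    CodeAt (pre ++ code ++ post) pre.length code :=
  codeAt_of_eq_append rfl

/-! ## Stores and the big-step semantics -/

/-- The data part of a configuration: memory and query log (the program counter is managed by the
compiler, and structured code has no `rand`, so the coin position never changes). [folklore] -/
@[ext]
structure Store where
  /-- Memory. -/
  mem : ℕ → ℕ
  /-- The oracle queries made so far, oldest first. -/
  queries : List (List ℕ)

/-- The configuration with program counter `pc`, coin position `cp` and the data of `st`. [folklore] -/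
def Store.cfg (st : Store) (pc : Option ℕ) (cp : ℕ) : Cfg :=
  ⟨pc, st.mem, cp, st.queries⟩

/-- The memory of `st.cfg pc cp`. [folklore] -/
@[simp] theorem Store.cfg_mem (st : Store) (pc : Option ℕ) (cp : ℕ) : (st.cfg pc cp).mem = st.mem := rfl
/-- The program counter of `st.cfg pc cp`. [folklore] -/
@[simp] theorem Store.cfg_pc (st : Store) (pc : Option ℕ) (cp : ℕ) : (st.cfg pc cp).pc = pc := rfl
/-- The coin position of `st.cfg pc cp`. [folklore] -/
@[simp] theorem Store.cfg_coinPos (st : Store) (pc : Option ℕ) (cp : ℕ) : (st.cfg pc cp).coinPos = cp := rfl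
/-- The query log of `st.cfg pc cp`. [folklore] -/
@[simp] theorem Store.cfg_queries (st : Store) (pc : Option ℕ) (cp : ℕ) : (st.cfg pc cp).queries = st.queries := rfl

/-- The store after the instruction `dst := o x y` at word size `w`. [folklore] -/
def Store.op (w : ℕ) (o : BinOp) (dst x y : Operand) (st : Store) : Store :=
  ⟨dst.write st.mem (o.eval w (x.read st.mem) (y.read st.mem)), st.queries⟩

/-- The store after the oracle query `query qa ql aa` at word size `w` with oracle `O`
(cf. `WordRAM.step`): the answer (reduced modulo `2 ^ w`) is written after its length at the
answer address, and the query is logged. [folklore] -/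
def Store.query (w : ℕ) (O : List ℕ → List ℕ) (qa ql aa : Operand) (st : Store) : Store :=
  let q := readSeg st.mem (qa.read st.mem) (ql.read st.mem)
  let ans := (O q).map (· % 2 ^ w)
  ⟨writeSeg (Function.update st.mem (aa.read st.mem) ans.length) (aa.read st.mem + 1) ans,
    st.queries ++ [q]⟩

namespace SProg

/-- **Big-step semantics with exact time.** `Exec w O s st st' t`: at word size `w` with oracle `O`,
the structured code `s` started in store `st` terminates in store `st'`, and its compiled code takes
exactly `t` machine steps to do so (one per instruction executed, including tests and jumps).
(Nipkow–Klein, *Concrete Semantics*, §7.2, instrumented with the step count of §8.4.) [folklore] -/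
inductive Exec (w : ℕ) (O : List ℕ → List ℕ) : SProg → Store → Store → ℕ → Prop
  /-- One `op` instruction: one step. -/
  | op (o : BinOp) (dst x y : Operand) (st : Store) :
      Exec w O (op o dst x y) st (st.op w o dst x y) 1
  /-- One `query` instruction: one step. -/
  | query (qa ql aa : Operand) (st : Store) :
      Exec w O (query qa ql aa) st (st.query w O qa ql aa) 1
  /-- `skip`: no step. -/
  | skip (st : Store) : Exec w O skip st st 0
  /-- Sequencing adds times. -/
  | seq {s u : SProg} {st st' st'' : Store} {t₁ t₂ : ℕ} (h₁ : Exec w O s st st' t₁)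
      (h₂ : Exec w O u st' st'' t₂) : Exec w O (seq s u) st st'' (t₁ + t₂)
  /-- Conditional, operand reads `0`: the test jumps to the code of `s` (one step), then `s`. -/
  | ifz_zero {x : Operand} {s u : SProg} {st st' : Store} {t : ℕ} (hx : x.read st.mem = 0)
      (h : Exec w O s st st' t) : Exec w O (ifz x s u) st st' (t + 1)
  /-- Conditional, operand reads nonzero: run `u` (test, branch, and the closing jump). -/
  | ifz_ne {x : Operand} {s u : SProg} {st st' : Store} {t : ℕ} (hx : x.read st.mem ≠ 0)
      (h : Exec w O u st st' t) : Exec w O (ifz x s u) st st' (t + 2)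
  /-- Loop exit: operand reads `0`, one test step. -/
  | while_zero {x : Operand} {s : SProg} {st : Store} (hx : x.read st.mem = 0) :
      Exec w O (whilenz x s) st st 1
  /-- Loop iteration: test, body, jump back, rest of the loop. -/
  | while_ne {x : Operand} {s : SProg} {st st' st'' : Store} {t t' : ℕ} (hx : x.read st.mem ≠ 0)
      (h : Exec w O s st st' t) (h' : Exec w O (whilenz x s) st' st'' t') :
      Exec w O (whilenz x s) st st'' (t + t' + 2)

/-! ## Compiler correctness -/

/-- **Compiler correctness** (Nipkow–Klein, *Concrete Semantics*, Lemma 8.8 / Thm. 8.9, here with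
exact step counts): if the code of `s` compiled for position `b` occurs in `P` at `b`, then an
execution `Exec w O s st st' t` is realised by the machine: `t` steps of `P` from program counter
`b` and store `st` lead to program counter `b + s.len` and store `st'` (any coin position, any coin
stream). [folklore] -/
theorem Exec.run_eq {w : ℕ} {O : List ℕ → List ℕ} {s : SProg} {st st' : Store} {t : ℕ}
    (h : Exec w O s st st' t) :
    ∀ {P : Program} {b : ℕ}, CodeAt P b (s.compile b) → ∀ (cp : ℕ) (ρ : ℕ → ℕ),
      run P w O ρ t (st.cfg (some b) cp) = some (st'.cfg (some (b + s.len)) cp) := by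
  induction h with
  | op o dst x y st =>
    intro P b hc cp ρ
    rw [run_one, step_op (i := b) rfl hc.getElem?_zero]
    rfl
  | query qa ql aa st =>
    intro P b hc cp ρ
    rw [run_one, step_query (i := b) rfl hc.getElem?_zero]
    rfl
  | skip st => intro P b hc cp ρ; rfl
  | @seq s u st st' st'' t₁ t₂ h₁ h₂ ih₁ ih₂ =>
    intro P b hc cp ρ
    have hc₂ := hc.right
    rw [length_compile] at hc₂
    rw [run_add_of_run _ _ _ _ (ih₁ hc.left cp ρ) (ih₂ hc₂ cp ρ), len, Nat.add_assoc]
  | @ifz_zero x s u st st' t hx h ih =>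
    intro P b hc cp ρ
    have hjz : step P w O ρ (st.cfg (some b) cp) = some (st.cfg (some (b + u.len + 2)) cp) :=
      step_jz_zero (i := b) rfl hc.getElem?_zero hx
    have hcs : CodeAt P (b + u.len + 2) (s.compile (b + u.len + 2)) := by
      have := (hc.tail.right).tail
      rw [length_compile] at this
      exact this.of_eq (by omega)
    rw [run_succ_of_step _ _ _ _ hjz, ih hcs cp ρ, len]
    congr 3
    omega
  | @ifz_ne x s u st st' t hx h ih =>
    intro P b hc cp ρ
    have hjz : step P w O ρ (st.cfg (some b) cp) = some (st.cfg (some (b + 1)) cp) :=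
      step_jz_ne (i := b) rfl hc.getElem?_zero hx
    have hcu : CodeAt P (b + 1) (u.compile (b + 1)) := hc.tail.left
    have hjmp : P[b + 1 + u.len]? = some (.jmp (b + (s.len + u.len + 2))) := by
      have := (hc.tail.right).getElem?_zero
      rwa [length_compile] at this
    show run P w O ρ ((t + 1) + 1) _ = _
    rw [run_succ_of_step _ _ _ _ hjz,
      run_add_of_run (n := 1) _ _ _ _ (ih hcu cp ρ) (run_one _ _ _ _ _),
      step_jmp (i := b + 1 + u.len) rfl hjmp]
    rfl
  | @while_zero x s st hx =>
    intro P b hc cp ρ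
    rw [run_one, step_jz_zero (i := b) rfl hc.getElem?_zero hx]
    rfl
  | @while_ne x s st st' st'' t t' hx h h' ih ih' =>
    intro P b hc cp ρ
    have hjz : step P w O ρ (st.cfg (some b) cp) = some (st.cfg (some (b + 1)) cp) :=
      step_jz_ne (i := b) rfl hc.getElem?_zero hx
    have hcs : CodeAt P (b + 1) (s.compile (b + 1)) := hc.tail.left
    have hjmp : P[b + 1 + s.len]? = some (.jmp b) := by
      have := (hc.tail.right).getElem?_zero
      rwa [length_compile] at this
    have hback : step P w O ρ (st'.cfg (some (b + 1 + s.len)) cp) = some (st'.cfg (some b) cp) :=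
      step_jmp (i := b + 1 + s.len) rfl hjmp
    show run P w O ρ ((t + (t' + 1)) + 1) _ = _
    rw [run_succ_of_step _ _ _ _ hjz,
      run_add_of_run (n := t' + 1) _ _ _ _ (ih hcs cp ρ) (run_succ_of_step _ _ _ _ hback t'),
      ih' hc cp ρ]

/-- **Halting certificate for a compiled program.** If the structured code `s`, started on the
initial memory of input `x` with empty query log, executes to store `st'` in `t` steps, then
`s.toProgram` halts on `x` within any `T ≥ t + 1` steps in the configuration with memory `st'.mem`,
query log `st'.queries`, coin position `0`. [folklore] -/
theorem haltsWithin_toProgram {w : ℕ} {O : List ℕ → List ℕ} {s : SProg} {x : List ℕ}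
    {st' : Store} {t T : ℕ} (h : Exec w O s ⟨(init w x).mem, []⟩ st' t) (hT : t + 1 ≤ T)
    (ρ : ℕ → ℕ) : HaltsWithin s.toProgram w O ρ x T (st'.cfg none 0) := by
  have hc : CodeAt s.toProgram 0 (s.compile 0) := by
    simpa [toProgram] using codeAt_append_middle [] (s.compile 0) [Instr.halt]
  have hrun := h.run_eq hc 0 ρ
  have hinit : (⟨(init w x).mem, []⟩ : Store).cfg (some 0) 0 = init w x := rfl
  rw [hinit, Nat.zero_add] at hrun
  have hhalt : s.toProgram[s.len]? = some .halt := by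
    simp [toProgram]
  have hstep : step s.toProgram w O ρ (st'.cfg (some s.len) 0) = some (st'.cfg none 0) :=
    step_halt (i := s.len) rfl hhalt
  exact haltsWithin_of_run (run_add_of_run (n := 1) _ _ _ _ hrun (by rw [run_one, hstep]))
    (step_of_pc_eq_none rfl) hT

/-- **Output certificate for a compiled program**: under the hypotheses of
`haltsWithin_toProgram`, `s.toProgram` outputs `readOut st'.mem` within `T` steps. [folklore] -/
theorem outputsWithin_toProgram {w : ℕ} {O : List ℕ → List ℕ} {s : SProg} {x : List ℕ}
    {st' : Store} {t T : ℕ} (h : Exec w O s ⟨(init w x).mem, []⟩ st' t) (hT : t + 1 ≤ T)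
    (ρ : ℕ → ℕ) : OutputsWithin s.toProgram w O ρ x (readOut st'.mem) T :=
  (outputsWithin_iff_exists_haltsWithin _ _ _ _ _ _ _).2 ⟨_, haltsWithin_toProgram h hT ρ, rfl⟩

/-! ## Derived rules -/

/-- **The loop rule.** A family of stores `st 0, …, st N` threaded through the body (`x` reads
nonzero before each of the `N` iterations and `0` after the last) gives an execution of
`whilenz x s` from `st 0` to `st N` in `1 + ∑ (tm i + 2)` steps. [folklore] -/
theorem Exec.whilenz_iter {w : ℕ} {O : List ℕ → List ℕ} {x : Operand} {s : SProg} (N : ℕ)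
    (st : ℕ → Store) (tm : ℕ → ℕ) (hne : ∀ i, i < N → x.read (st i).mem ≠ 0)
    (hz : x.read (st N).mem = 0) (hbody : ∀ i, i < N → Exec w O s (st i) (st (i + 1)) (tm i)) :
    Exec w O (whilenz x s) (st 0) (st N) (1 + ∑ i ∈ Finset.range N, (tm i + 2)) := by
  induction N generalizing st tm with
  | zero => simpa using Exec.while_zero hz
  | succ N ih =>
    have h := ih (fun i => st (i + 1)) (fun i => tm (i + 1)) (fun i hi => hne (i + 1) (by omega))
      hz (fun i hi => hbody (i + 1) (by omega))
    have := Exec.while_ne (hne 0 (by omega)) (hbody 0 (by omega)) h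
    convert this using 1
    rw [Finset.sum_range_succ']
    omega

/-- `ExecLE w O s st st' T`: `s` executes from `st` to `st'` in at most `T` steps. [folklore] -/
def ExecLE (w : ℕ) (O : List ℕ → List ℕ) (s : SProg) (st st' : Store) (T : ℕ) : Prop :=
  ∃ t, t ≤ T ∧ Exec w O s st st' t

/-- Weakening the time bound. [folklore] -/
theorem ExecLE.mono {w : ℕ} {O : List ℕ → List ℕ} {s : SProg} {st st' : Store} {T T' : ℕ}
    (h : ExecLE w O s st st' T) (hT : T ≤ T') : ExecLE w O s st st' T' := by
  obtain ⟨t, ht, h⟩ := h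
  exact ⟨t, ht.trans hT, h⟩

/-- An exact execution is a bounded one. [folklore] -/
theorem Exec.execLE {w : ℕ} {O : List ℕ → List ℕ} {s : SProg} {st st' : Store} {t : ℕ}
    (h : Exec w O s st st' t) : ExecLE w O s st st' t :=
  ⟨t, le_rfl, h⟩

/-- `op` in at most one step (any bound `≥ 1`). [folklore] -/
theorem ExecLE.op {w : ℕ} {O : List ℕ → List ℕ} (o : BinOp) (dst x y : Operand) (st : Store)
    {T : ℕ} (hT : 1 ≤ T) : ExecLE w O (op o dst x y) st (st.op w o dst x y) T :=
  ⟨1, hT, Exec.op o dst x y st⟩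

/-- `query` in at most one step. [folklore] -/
theorem ExecLE.query {w : ℕ} {O : List ℕ → List ℕ} (qa ql aa : Operand) (st : Store) {T : ℕ}
    (hT : 1 ≤ T) : ExecLE w O (query qa ql aa) st (st.query w O qa ql aa) T :=
  ⟨1, hT, Exec.query qa ql aa st⟩

/-- `skip` in no steps. [folklore] -/
theorem ExecLE.skip {w : ℕ} {O : List ℕ → List ℕ} (st : Store) (T : ℕ) : ExecLE w O skip st st T :=
  ⟨0, Nat.zero_le _, Exec.skip st⟩

/-- Sequencing of bounded executions. [folklore] -/
theorem ExecLE.seq {w : ℕ} {O : List ℕ → List ℕ} {s u : SProg} {st st' st'' : Store} {T₁ T₂ : ℕ}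
    (h₁ : ExecLE w O s st st' T₁) (h₂ : ExecLE w O u st' st'' T₂) :
    ExecLE w O (seq s u) st st'' (T₁ + T₂) := by
  obtain ⟨t₁, ht₁, h₁⟩ := h₁
  obtain ⟨t₂, ht₂, h₂⟩ := h₂
  exact ⟨t₁ + t₂, Nat.add_le_add ht₁ ht₂, Exec.seq h₁ h₂⟩

/-- Conditional, zero case, bounded. [folklore] -/
theorem ExecLE.ifz_zero {w : ℕ} {O : List ℕ → List ℕ} {x : Operand} {s u : SProg} {st st' : Store}
    {T : ℕ} (hx : x.read st.mem = 0) (h : ExecLE w O s st st' T) :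
    ExecLE w O (ifz x s u) st st' (T + 2) := by
  obtain ⟨t, ht, h⟩ := h
  exact ⟨t + 1, by omega, Exec.ifz_zero hx h⟩

/-- Conditional, nonzero case, bounded. [folklore] -/
theorem ExecLE.ifz_ne {w : ℕ} {O : List ℕ → List ℕ} {x : Operand} {s u : SProg} {st st' : Store}
    {T : ℕ} (hx : x.read st.mem ≠ 0) (h : ExecLE w O u st st' T) :
    ExecLE w O (ifz x s u) st st' (T + 2) := by
  obtain ⟨t, ht, h⟩ := h
  exact ⟨t + 2, by omega, Exec.ifz_ne hx h⟩

/-- **The bounded loop rule**: `N` iterations of a body bounded by `K` steps give the loop in at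
most `N * (K + 2) + 1` steps. [folklore] -/
theorem ExecLE.whilenz_iter {w : ℕ} {O : List ℕ → List ℕ} {x : Operand} {s : SProg} (N : ℕ)
    (st : ℕ → Store) (K : ℕ) (hne : ∀ i, i < N → x.read (st i).mem ≠ 0)
    (hz : x.read (st N).mem = 0) (hbody : ∀ i, i < N → ExecLE w O s (st i) (st (i + 1)) K) :
    ExecLE w O (whilenz x s) (st 0) (st N) (N * (K + 2) + 1) := by
  choose! tm htm hex using hbody
  refine ⟨_, ?_, Exec.whilenz_iter N st tm hne hz hex⟩
  have : ∑ i ∈ Finset.range N, (tm i + 2) ≤ ∑ i ∈ Finset.range N, (K + 2) :=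
    Finset.sum_le_sum fun i hi => Nat.add_le_add_right (htm i (Finset.mem_range.1 hi)) 2
  rw [Finset.sum_const, Finset.card_range, smul_eq_mul] at this
  omega

/-- **The invariant loop rule** (Hoare's `while` rule with a variant counting the remaining
iterations; Nipkow–Klein §12.2): if from every store satisfying `Inv i` (`i < N`) the test operand
reads nonzero and the body reaches, within `K` steps, a store satisfying `Inv (i + 1)`, and `Inv N`
forces the test operand to read `0`, then from `Inv 0` the loop reaches `Inv N` within
`N * (K + 2) + 1` steps. [folklore] -/
theorem ExecLE.whilenz_invariant {w : ℕ} {O : List ℕ → List ℕ} {x : Operand} {s : SProg} (N K : ℕ)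
    (Inv : ℕ → Store → Prop)
    (hbody : ∀ i, i < N → ∀ st, Inv i st →
      x.read st.mem ≠ 0 ∧ ∃ st', ExecLE w O s st st' K ∧ Inv (i + 1) st')
    (hexit : ∀ st, Inv N st → x.read st.mem = 0) {st : Store} (h0 : Inv 0 st) :
    ∃ st', ExecLE w O (whilenz x s) st st' (N * (K + 2) + 1) ∧ Inv N st' := by
  suffices h : ∀ j, j ≤ N → ∀ st, Inv (N - j) st →
      ∃ st', ExecLE w O (whilenz x s) st st' (j * (K + 2) + 1) ∧ Inv N st' by
    simpa using h N le_rfl st (by simpa using h0)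
  intro j
  induction j with
  | zero =>
    intro _ st hst
    exact ⟨st, ⟨1, by omega, Exec.while_zero (hexit st hst)⟩, hst⟩
  | succ j ih =>
    intro hj st hst
    obtain ⟨hne, st₁, ⟨t₁, ht₁, hex₁⟩, hst₁⟩ := hbody (N - (j + 1)) (by omega) st hst
    rw [show N - (j + 1) + 1 = N - j by omega] at hst₁
    obtain ⟨st', ⟨t', ht', hex'⟩, hst'⟩ := ih (by omega) st₁ hst₁
    refine ⟨st', ⟨t₁ + t' + 2, ?_, Exec.while_ne hne hex₁ hex'⟩, hst'⟩
    rw [Nat.succ_mul]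
    omega

/-- Chaining bounded executions through an intermediate specification. [folklore] -/
theorem ExecLE.seq_of_exists {w : ℕ} {O : List ℕ → List ℕ} {s u : SProg} {st : Store}
    {T₁ T₂ : ℕ} {P Q : Store → Prop} (h₁ : ∃ st', ExecLE w O s st st' T₁ ∧ P st')
    (h₂ : ∀ st', P st' → ∃ st'', ExecLE w O u st' st'' T₂ ∧ Q st'') :
    ∃ st'', ExecLE w O (SProg.seq s u) st st'' (T₁ + T₂) ∧ Q st'' := by
  obtain ⟨st', h₁, hP⟩ := h₁
  obtain ⟨st'', h₂, hQ⟩ := h₂ st' hP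
  exact ⟨st'', h₁.seq h₂, hQ⟩

end SProg

/-! ## Runtime conventions: the initial memory, split memories -/

/-- The initial memory on input `x` as a total function (when the word size is at least the input
width, so that nothing is truncated): cell `0` holds `|x|`, cell `a ≥ 1` holds `x[a - 1]` (and `0`
past the input, by `List.getD`). [folklore] -/
def initFun (x : List ℕ) : ℕ → ℕ :=
  fun a => if a = 0 then x.length else x.getD (a - 1) 0

/-- `init w x` has memory `initFun x` when `inputWidth x ≤ w`. [folklore] -/
theorem init_mem_eq_initFun {w : ℕ} {x : List ℕ} (h : inputWidth x ≤ w) :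
    (init w x).mem = initFun x := by
  have hw : ∀ v, v < 2 ^ inputWidth x → v % 2 ^ w = v := fun v hv =>
    Nat.mod_eq_of_lt (lt_of_lt_of_le hv (Nat.pow_le_pow_right Nat.two_pos h))
  funext a
  unfold initFun
  rcases Nat.eq_zero_or_pos a with rfl | ha
  · rw [if_pos rfl, init_mem_zero, hw _ (length_lt_two_pow_inputWidth x)]
  · rw [if_neg ha.ne']
    obtain ⟨i, rfl⟩ := Nat.exists_eq_add_of_le' ha
    rw [Nat.add_sub_cancel]
    by_cases hi : i < x.length
    · rw [init_mem_succ w x i hi, hw _ (lt_two_pow_inputWidth_of_mem x _ (List.getElem_mem hi)),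
        List.getD_eq_getElem _ _ hi]
    · rw [init_mem_of_length_lt w x (i + 1) (by omega), List.getD_eq_default _ _ (by omega)]

/-- `merge S H`: the memory that is `S` on the scratch addresses `< 100` and `H` on the data
addresses `≥ 100` — the convention of the verified programs of this library, which keep their
finitely many registers at fixed literal addresses below `100` and all data above. [folklore] -/
def merge (S H : ℕ → ℕ) : ℕ → ℕ :=
  fun a => if a < 100 then S a else H a

/-- Reading a scratch cell of a merged memory. [folklore] -/
theorem merge_apply_of_lt {S H : ℕ → ℕ} {a : ℕ} (ha : a < 100) : merge S H a = S a := if_pos ha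

/-- Reading a data cell of a merged memory. [folklore] -/
theorem merge_apply_of_le {S H : ℕ → ℕ} {a : ℕ} (ha : 100 ≤ a) : merge S H a = H a :=
  if_neg (Nat.not_lt.2 ha)

/-- Writing a scratch cell of a merged memory. [folklore] -/
theorem update_merge_of_lt (S H : ℕ → ℕ) {a : ℕ} (ha : a < 100) (v : ℕ) :
    Function.update (merge S H) a v = merge (Function.update S a v) H := by
  funext b
  by_cases hb : b = a
  · subst hb; simp [merge, ha]
  · rw [Function.update_of_ne hb]
    unfold merge
    rw [Function.update_of_ne hb]

/-- Writing a data cell of a merged memory. [folklore] -/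
theorem update_merge_of_le (S H : ℕ → ℕ) {a : ℕ} (ha : 100 ≤ a) (v : ℕ) :
    Function.update (merge S H) a v = merge S (Function.update H a v) := by
  funext b
  by_cases hb : b = a
  · subst hb; simp [merge, Nat.not_lt.2 ha]
  · rw [Function.update_of_ne hb]
    unfold merge
    rw [Function.update_of_ne hb]

/-- Any memory splits as `merge` of itself with itself. [folklore] -/
theorem merge_self (m : ℕ → ℕ) : merge m m = m := by
  funext a; unfold merge; split_ifs <;> rfl

/-- Reading a direct register operand of a merged memory. [folklore] -/
theorem Operand.read_dir_merge {S H : ℕ → ℕ} {d : ℕ} (hd : d < 100) :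
    (Operand.dir d).read (merge S H) = S d := merge_apply_of_lt hd

/-- Reading through a register that points into the data. [folklore] -/
theorem Operand.read_ind_merge {S H : ℕ → ℕ} {p : ℕ} (hp : p < 100) (hP : 100 ≤ S p) :
    (Operand.ind p).read (merge S H) = H (S p) := by
  rw [Operand.read_ind, merge_apply_of_lt hp, merge_apply_of_le hP]

/-- `segWrite H A l`: the data memory after an oracle answer `l` has been written at address `A`
(its length at `A`, its words from `A + 1` on), as a total function. [folklore] -/
def segWrite (H : ℕ → ℕ) (A : ℕ) (l : List ℕ) : ℕ → ℕ := fun a =>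
  if a = A then l.length else if A < a ∧ a ≤ A + l.length then l.getD (a - A - 1) 0 else H a

/-- The answer-writing of `WordRAM.step`/`Store.query` lands in the data part of a merged memory
when the answer address is a data address. [folklore] -/
theorem writeSeg_update_merge {S H : ℕ → ℕ} {A : ℕ} (hA : 100 ≤ A) (l : List ℕ) :
    writeSeg (Function.update (merge S H) A l.length) (A + 1) l = merge S (segWrite H A l) := by
  funext b
  rw [writeSeg_apply]
  by_cases hb : A + 1 ≤ b ∧ b < A + 1 + l.length
  · rw [dif_pos hb, merge_apply_of_le (show 100 ≤ b by omega)]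
    unfold segWrite
    rw [if_neg (by omega), if_pos ⟨by omega, by omega⟩, List.getD_eq_getElem _ _ (by omega)]
    congr 1
  · rw [dif_neg hb]
    by_cases hbA : b = A
    · subst hbA
      rw [Function.update_self, merge_apply_of_le hA]
      unfold segWrite; rw [if_pos rfl]
    · rw [Function.update_of_ne hbA]
      by_cases hb100 : b < 100
      · rw [merge_apply_of_lt hb100, merge_apply_of_lt hb100]
      · rw [merge_apply_of_le (by omega), merge_apply_of_le (by omega)]
        unfold segWrite
        rw [if_neg hbA, if_neg (by omega)]

/-- Reading a segment of data addresses of a merged memory reads the data part. [folklore] -/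
theorem readSeg_merge_of_le {S H : ℕ → ℕ} {a len : ℕ} (ha : 100 ≤ a) :
    readSeg (merge S H) a len = readSeg H a len :=
  readSeg_congr fun j _ => merge_apply_of_le (by omega)

/-- A segment of a memory given by a total function is the list of its values. [folklore] -/
theorem readSeg_eq_of_forall {m : ℕ → ℕ} {a len : ℕ} {l : List ℕ} (hlen : l.length = len)
    (h : ∀ j (hj : j < len), m (a + j) = l[j]'(hlen ▸ hj)) : readSeg m a len = l := by
  apply List.ext_getElem (by simp [hlen])
  intro j hj _
  simp only [readSeg, List.getElem_map, List.getElem_range]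
  exact h j (by simpa using hj)

namespace SProg

variable {w : ℕ} {O : List ℕ → List ℕ}

/-- Executing `dst := o x y` with a register destination on a merged memory. [folklore] -/
theorem Exec.op_dir {d : ℕ} (hd : d < 100) (o : BinOp) (x y : Operand) (S H : ℕ → ℕ)
    (qs : List (List ℕ)) :
    Exec w O (SProg.op o (.dir d) x y) ⟨merge S H, qs⟩
      ⟨merge (Function.update S d (o.eval w (x.read (merge S H)) (y.read (merge S H)))) H, qs⟩ 1 := by
  have := Exec.op (w := w) (O := O) o (.dir d) x y ⟨merge S H, qs⟩
  simp only [Store.op, Operand.write] at this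
  rwa [update_merge_of_lt S H hd] at this

/-- Executing `mem[p] := o x y` through a register `p` pointing into the data. [folklore] -/
theorem Exec.op_ind {p : ℕ} (hp : p < 100) {S : ℕ → ℕ} (hP : 100 ≤ S p) (o : BinOp)
    (x y : Operand) (H : ℕ → ℕ) (qs : List (List ℕ)) :
    Exec w O (SProg.op o (.ind p) x y) ⟨merge S H, qs⟩
      ⟨merge S (Function.update H (S p) (o.eval w (x.read (merge S H)) (y.read (merge S H)))), qs⟩
      1 := by
  have := Exec.op (w := w) (O := O) o (.ind p) x y ⟨merge S H, qs⟩
  simp only [Store.op, Operand.write] at this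
  rwa [merge_apply_of_lt hp, update_merge_of_le S H hP] at this

/-- `Exec.op_dir` with the written value supplied in closed form. [folklore] -/
theorem Exec.op_dir' {d : ℕ} (hd : d < 100) {o : BinOp} {x y : Operand} {S H : ℕ → ℕ}
    {qs : List (List ℕ)} {v : ℕ} (hv : o.eval w (x.read (merge S H)) (y.read (merge S H)) = v) :
    Exec w O (SProg.op o (.dir d) x y) ⟨merge S H, qs⟩ ⟨merge (Function.update S d v) H, qs⟩ 1 :=
  hv ▸ Exec.op_dir hd o x y S H qs

/-- `Exec.op_ind` with the address and the written value supplied in closed form. [folklore] -/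
theorem Exec.op_ind' {p : ℕ} (hp : p < 100) {S : ℕ → ℕ} {A : ℕ} (hSp : S p = A) (hA : 100 ≤ A)
    {o : BinOp} {x y : Operand} {H : ℕ → ℕ} {qs : List (List ℕ)} {v : ℕ}
    (hv : o.eval w (x.read (merge S H)) (y.read (merge S H)) = v) :
    Exec w O (SProg.op o (.ind p) x y) ⟨merge S H, qs⟩ ⟨merge S (Function.update H A v), qs⟩ 1 := by
  subst hSp hv; exact Exec.op_ind hp hA o x y H qs

/-- Executing an oracle query whose segment, length and answer registers are `qa`, `ql`, `aa`
(registers holding data addresses) on a merged memory: the query is the data segment, and the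
answer is written into the data part. [folklore] -/
theorem Exec.query_dir {qa ql aa : ℕ} (hqa : qa < 100) (hql : ql < 100) (haa : aa < 100)
    {S : ℕ → ℕ} (hQ : 100 ≤ S qa) (hA : 100 ≤ S aa) (H : ℕ → ℕ) (qs : List (List ℕ)) :
    Exec w O (SProg.query (.dir qa) (.dir ql) (.dir aa)) ⟨merge S H, qs⟩
      ⟨merge S (segWrite H (S aa) ((O (readSeg H (S qa) (S ql))).map (· % 2 ^ w))),
        qs ++ [readSeg H (S qa) (S ql)]⟩ 1 := by
  have := Exec.query (w := w) (O := O) (.dir qa) (.dir ql) (.dir aa) ⟨merge S H, qs⟩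
  simp only [Store.query, Operand.read_dir, merge_apply_of_lt hqa, merge_apply_of_lt hql,
    merge_apply_of_lt haa, readSeg_merge_of_le hQ] at this
  rwa [writeSeg_update_merge hA] at this

end SProg

/-! ## The relocation bootstrap

Every verified program of this library starts by moving its input out of the low addresses, so
that the cells `2, …, 99` become free registers: `SProg.relocate` copies the input words
`x₁ … x_L` (initially in cells `1 … L`, with `L = |x|` in cell `0`) to the cells `D + 1, …, D + L`
where `D := L + 100`, using only the cells `0` and `1` as registers, in exactly `7 L` steps. -/

namespace SProg

/-- The relocation bootstrap (registers: cells `0`, `1` only):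
`c0 := L + 100 (= D); mem[D] := x₁; c1 := D; c0 := L - 1;`
`while c0 ≠ 0 { c0 += 1; c1 += c0; mem[c1] := mem[c0]; c1 -= c0; c0 -= 2 };`
`c0 := D + 1; mem[D + 1] := mem[D]`. The loop copies `x_L, x_{L-1}, …, x_2` (top down) and the
last two instructions place `x₁`. [folklore] -/
def relocate : SProg :=
  seq (seq (op .add (.dir 0) (.dir 0) (.imm 100)) <|
       seq (op .add (.ind 0) (.dir 1) (.imm 0)) <|
       seq (op .add (.dir 1) (.dir 0) (.imm 0)) (op .sub (.dir 0) (.dir 0) (.imm 101))) <|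
  seq (whilenz (.dir 0)
        (seq (op .add (.dir 0) (.dir 0) (.imm 1)) <|
         seq (op .add (.dir 1) (.dir 1) (.dir 0)) <|
         seq (op .add (.ind 1) (.ind 0) (.imm 0)) <|
         seq (op .sub (.dir 1) (.dir 1) (.dir 0))
             (op .sub (.dir 0) (.dir 0) (.imm 2))))
      (seq (op .add (.dir 0) (.dir 1) (.imm 1)) (op .add (.ind 0) (.ind 1) (.imm 0)))

/-- `relocate` makes no oracle query. [folklore] -/
theorem relocate_queryFree : relocate.QueryFree := by
  simp [relocate, QueryFree]

/-- The memory after `j` iterations of the loop of `relocate` on input `x` (`L = |x|`,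
`D = L + 100`): registers `c0 = L - 1 - j`, `c1 = D`; `mem[D] = x₁`; the top `j` input words
copied to `D + (L - j) + 1, …, D + L`; the input still in place in cells `2, …, L`. [folklore] -/
def relocMem (x : List ℕ) (j : ℕ) : ℕ → ℕ := fun a =>
  if a = 0 then x.length - 1 - j
  else if a = 1 then x.length + 100
  else if a = x.length + 100 then x.getD 0 0
  else if x.length + 100 + (x.length - j) < a ∧ a ≤ x.length + 100 + x.length then
    x.getD (a - (x.length + 100) - 1) 0
  else if a ≤ x.length then x.getD (a - 1) 0
  else 0

/-- **The relocated memory** of input `x` (`L = |x|`, `D = L + 100`): cell `0` holds `D + 1`,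
cell `1` holds `D`, cell `D` holds `x₁`, cells `D + 1, …, D + L` hold `x₁, …, x_L`, cells
`2, …, L` still hold `x₂, …, x_L`, and every other cell holds `0`. [folklore] -/
def relocated (x : List ℕ) : ℕ → ℕ := fun a =>
  if a = 0 then x.length + 100 + 1
  else if a = 1 then x.length + 100
  else if a = x.length + 100 then x.getD 0 0
  else if x.length + 100 < a ∧ a ≤ x.length + 100 + x.length then
    x.getD (a - (x.length + 100) - 1) 0
  else if a ≤ x.length then x.getD (a - 1) 0
  else 0

/-- The data cells of the relocated memory: `x_i` sits at `D + i` (`1 ≤ i ≤ L`). [folklore] -/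
theorem relocated_base_add (x : List ℕ) {i : ℕ} (hi : 1 ≤ i) (hi' : i ≤ x.length) :
    relocated x (x.length + 100 + i) = x.getD (i - 1) 0 := by
  unfold relocated
  rw [if_neg (by omega), if_neg (by omega), if_neg (by omega), if_pos ⟨by omega, by omega⟩]
  congr 1; omega

/-- Above the data, the relocated memory is `0`. [folklore] -/
theorem relocated_of_lt (x : List ℕ) {a : ℕ} (ha : x.length + 100 + x.length < a) :
    relocated x a = 0 := by
  unfold relocated
  rw [if_neg (by omega), if_neg (by omega), if_neg (by omega), if_neg (by omega), if_neg (by omega)]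

/-- Cell `0` of the relocated memory. [folklore] -/
@[simp] theorem relocated_zero (x : List ℕ) : relocated x 0 = x.length + 100 + 1 := rfl

/-- Cell `1` of the relocated memory. [folklore] -/
@[simp] theorem relocated_one (x : List ℕ) : relocated x 1 = x.length + 100 := by
  simp [relocated]

section relocate

variable {w : ℕ} {O : List ℕ → List ℕ} {x : List ℕ}

/-- Register `c0` of `relocMem`. [folklore] -/
private theorem relocMem_zero (x : List ℕ) (j : ℕ) : relocMem x j 0 = x.length - 1 - j := rfl

/-- Register `c1` of `relocMem`. [folklore] -/
private theorem relocMem_one (x : List ℕ) (j : ℕ) : relocMem x j 1 = x.length + 100 := by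
  simp [relocMem]

/-- Cell `D` of `relocMem`. [folklore] -/
private theorem relocMem_base (x : List ℕ) (j : ℕ) : relocMem x j (x.length + 100) = x.getD 0 0 := by
  unfold relocMem; rw [if_neg (by omega), if_neg (by omega), if_pos rfl]

/-- The untouched input cells of `relocMem`. [folklore] -/
private theorem relocMem_low (x : List ℕ) (j : ℕ) {a : ℕ} (h2 : 2 ≤ a) (ha : a ≤ x.length) :
    relocMem x j a = x.getD (a - 1) 0 := by
  unfold relocMem
  rw [if_neg (by omega), if_neg (by omega), if_neg (by omega), if_neg (by omega), if_pos ha]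

/-- The four set-up instructions of `relocate`. [folklore] -/
private theorem relocate_setup (hL1 : 1 ≤ x.length) (hx : ∀ v ∈ x, v < 2 ^ w)
    (hL : 2 * x.length + 102 < 2 ^ w) (qs : List (List ℕ)) :
    Exec w O (seq (op .add (.dir 0) (.dir 0) (.imm 100)) <|
        seq (op .add (.ind 0) (.dir 1) (.imm 0)) <|
        seq (op .add (.dir 1) (.dir 0) (.imm 0)) (op .sub (.dir 0) (.dir 0) (.imm 101)))
      ⟨initFun x, qs⟩ ⟨relocMem x 0, qs⟩ (1 + (1 + (1 + 1))) := by
  have hx1 : x.getD 0 0 < 2 ^ w := by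
    cases x with
    | nil => simp
    | cons a l => simpa using hx a (by simp)
  have h0 : initFun x 0 = x.length := rfl
  have h1 : initFun x 1 = x.getD 0 0 := rfl
  have e1 : BinOp.add.eval w x.length 100 = x.length + 100 := BinOp.eval_add_of_lt (by omega)
  have e2 : BinOp.add.eval w (x.getD 0 0) 0 = x.getD 0 0 := BinOp.eval_add_of_lt (by omega)
  have e3 : BinOp.add.eval w (x.length + 100) 0 = x.length + 100 := BinOp.eval_add_of_lt (by omega)
  have e4 : BinOp.sub.eval w (x.length + 100) 101 = x.length - 1 :=
    (BinOp.eval_sub_of_le (by omega) (by omega)).trans (by omega)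
  have key : ((((⟨initFun x, qs⟩ : Store).op w .add (.dir 0) (.dir 0) (.imm 100)).op w .add
      (.ind 0) (.dir 1) (.imm 0)).op w .add (.dir 1) (.dir 0) (.imm 0)).op w .sub (.dir 0)
      (.dir 0) (.imm 101) = ⟨relocMem x 0, qs⟩ := by
    simp only [Store.op, Operand.read, Operand.write, Function.update_apply, Nat.reduceEqDiff,
      if_true, if_false, h0, h1, e1, e2, e3, e4, Store.mk.injEq, and_true]
    funext a
    simp only [Function.update_apply, relocMem, initFun]
    split_ifs <;> first | omega | rfl | exact List.getD_eq_default _ _ (by omega)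
  rw [← key]
  exact Exec.seq (Exec.op _ _ _ _ _) (Exec.seq (Exec.op _ _ _ _ _)
    (Exec.seq (Exec.op _ _ _ _ _) (Exec.op _ _ _ _ _)))

/-- One iteration of the loop of `relocate`. [folklore] -/
private theorem relocate_body (hx : ∀ v ∈ x, v < 2 ^ w) (hL : 2 * x.length + 102 < 2 ^ w)
    (qs : List (List ℕ)) {j : ℕ} (hj : j + 1 < x.length) :
    Exec w O (seq (op .add (.dir 0) (.dir 0) (.imm 1)) <|
         seq (op .add (.dir 1) (.dir 1) (.dir 0)) <|
         seq (op .add (.ind 1) (.ind 0) (.imm 0)) <|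
         seq (op .sub (.dir 1) (.dir 1) (.dir 0))
             (op .sub (.dir 0) (.dir 0) (.imm 2)))
      ⟨relocMem x j, qs⟩ ⟨relocMem x (j + 1), qs⟩ (1 + (1 + (1 + (1 + 1)))) := by
  have hxs : x.getD (x.length - j - 1) 0 < 2 ^ w := by
    rw [List.getD_eq_getElem _ _ (by omega)]
    exact hx _ (List.getElem_mem _)
  have h0 : relocMem x j 0 = x.length - 1 - j := rfl
  have h1 : relocMem x j 1 = x.length + 100 := relocMem_one x j
  have hs : relocMem x j (x.length - j) = x.getD (x.length - j - 1) 0 :=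
    relocMem_low x j (by omega) (by omega)
  have e1 : BinOp.add.eval w (x.length - 1 - j) 1 = x.length - j :=
    (BinOp.eval_add_of_lt (by omega)).trans (by omega)
  have e2 : BinOp.add.eval w (x.length + 100) (x.length - j) = x.length + 100 + (x.length - j) :=
    BinOp.eval_add_of_lt (by omega)
  have e3 : BinOp.add.eval w (x.getD (x.length - j - 1) 0) 0 = x.getD (x.length - j - 1) 0 :=
    BinOp.eval_add_of_lt (by omega)
  have e4 : BinOp.sub.eval w (x.length + 100 + (x.length - j)) (x.length - j) = x.length + 100 :=
    (BinOp.eval_sub_of_le (by omega) (by omega)).trans (by omega)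
  have e5 : BinOp.sub.eval w (x.length - j) 2 = x.length - 1 - (j + 1) :=
    (BinOp.eval_sub_of_le (by omega) (by omega)).trans (by omega)
  have hne2 : x.length - j ≠ 1 := by omega
  have hne3 : x.length - j ≠ 0 := by omega
  have hne4 : ¬ ((1 : ℕ) = x.length + 100 + (x.length - j)) := by omega
  have hne5 : ¬ ((0 : ℕ) = x.length + 100 + (x.length - j)) := by omega
  have key : (((((⟨relocMem x j, qs⟩ : Store).op w .add (.dir 0) (.dir 0) (.imm 1)).op w .add
      (.dir 1) (.dir 1) (.dir 0)).op w .add (.ind 1) (.ind 0) (.imm 0)).op w .sub (.dir 1)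
      (.dir 1) (.dir 0)).op w .sub (.dir 0) (.dir 0) (.imm 2) = ⟨relocMem x (j + 1), qs⟩ := by
    simp only [Store.op, Operand.read, Operand.write, Function.update_apply, Nat.reduceEqDiff,
      if_true, if_false, h0, h1, e1, e2, hne2, hne3, hne4, hne5, hs, e3, e4, e5, Store.mk.injEq,
      and_true]
    funext a
    simp only [Function.update_apply, relocMem]
    split_ifs <;>
      first
        | omega
        | (subst_vars; first | rfl | omega | (congr 1; omega))
  rw [← key]
  exact Exec.seq (Exec.op _ _ _ _ _) (Exec.seq (Exec.op _ _ _ _ _)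
    (Exec.seq (Exec.op _ _ _ _ _) (Exec.seq (Exec.op _ _ _ _ _) (Exec.op _ _ _ _ _))))

/-- The two closing instructions of `relocate`. [folklore] -/
private theorem relocate_finish (hx : ∀ v ∈ x, v < 2 ^ w) (hL : 2 * x.length + 102 < 2 ^ w)
    (hL1 : 1 ≤ x.length) (qs : List (List ℕ)) :
    Exec w O (seq (op .add (.dir 0) (.dir 1) (.imm 1)) (op .add (.ind 0) (.ind 1) (.imm 0)))
      ⟨relocMem x (x.length - 1), qs⟩ ⟨relocated x, qs⟩ (1 + 1) := by
  have hx1 : x.getD 0 0 < 2 ^ w := by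
    cases x with
    | nil => simp
    | cons a l => simpa using hx a (by simp)
  have h1 : relocMem x (x.length - 1) 1 = x.length + 100 := relocMem_one x _
  have hb : relocMem x (x.length - 1) (x.length + 100) = x.getD 0 0 := relocMem_base x _
  have e1 : BinOp.add.eval w (x.length + 100) 1 = x.length + 100 + 1 := BinOp.eval_add_of_lt (by omega)
  have e2 : BinOp.add.eval w (x.getD 0 0) 0 = x.getD 0 0 := BinOp.eval_add_of_lt (by omega)
  have hne1 : x.length + 100 ≠ 0 := by omega
  have key : (((⟨relocMem x (x.length - 1), qs⟩ : Store).op w .add (.dir 0) (.dir 1) (.imm 1)).op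
      w .add (.ind 0) (.ind 1) (.imm 0)) = ⟨relocated x, qs⟩ := by
    simp only [Store.op, Operand.read, Operand.write, Function.update_apply, Nat.reduceEqDiff,
      if_true, if_false, h1, hb, e1, e2, hne1, Store.mk.injEq, and_true]
    funext a
    simp only [Function.update_apply, relocMem, relocated]
    split_ifs <;>
      first
        | omega
        | (subst_vars; first | rfl | omega | (congr 1; omega))
  rw [← key]
  exact Exec.seq (Exec.op _ _ _ _ _) (Exec.op _ _ _ _ _)

/-- **Semantics of the relocation bootstrap.** On the initial memory of a nonempty input `x` all
of whose words, and `2|x| + 102`, are below `2 ^ w`, `relocate` ends with the memory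
`relocated x` after exactly `7 |x|` steps, without touching the query log. [folklore] -/
theorem relocate_exec (hL1 : 1 ≤ x.length) (hx : ∀ v ∈ x, v < 2 ^ w)
    (hL : 2 * x.length + 102 < 2 ^ w) (qs : List (List ℕ)) :
    Exec w O relocate ⟨initFun x, qs⟩ ⟨relocated x, qs⟩ (7 * x.length) := by
  have hloop : Exec w O (whilenz (.dir 0)
        (seq (op .add (.dir 0) (.dir 0) (.imm 1)) <|
         seq (op .add (.dir 1) (.dir 1) (.dir 0)) <|
         seq (op .add (.ind 1) (.ind 0) (.imm 0)) <|
         seq (op .sub (.dir 1) (.dir 1) (.dir 0))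
             (op .sub (.dir 0) (.dir 0) (.imm 2))))
      ⟨relocMem x 0, qs⟩ ⟨relocMem x (x.length - 1), qs⟩
      (1 + ∑ i ∈ Finset.range (x.length - 1), (1 + (1 + (1 + (1 + 1))) + 2)) := by
    refine Exec.whilenz_iter (x.length - 1) (fun j => ⟨relocMem x j, qs⟩) (fun _ => _)
      (fun i hi => ?_) ?_ (fun i hi => relocate_body hx hL qs (by omega))
    · show relocMem x i 0 ≠ 0
      rw [relocMem_zero]; omega
    · show relocMem x (x.length - 1) 0 = 0
      rw [relocMem_zero]; omega
  have := Exec.seq (relocate_setup (O := O) hL1 hx hL qs)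
    (Exec.seq hloop (relocate_finish (O := O) hx hL hL1 qs))
  rw [Finset.sum_const, Finset.card_range, smul_eq_mul] at this
  have ht : 7 * x.length =
      1 + (1 + (1 + 1)) + (1 + (x.length - 1) * (1 + (1 + (1 + (1 + 1))) + 2) + (1 + 1)) := by
    omega
  rw [ht]
  exact this

end relocate

end SProg

end Literature.Computability.Cryptography.WordRAM
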